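import Literature.Analysis.FluidPDE.AxisymRadialQuotient
import Literature.Analysis.FluidPDE.AxisymmetricEuler
import HarnessLib

/-!
# SwirlFreeBudget, brick for crux K-18.2 (T-18.5): LOCALITY of the smooth radial quotient
# `radQuot S x` (hence of `angVortQuot = radQuot (swirl (curl ·))`) (seat nsreg-p4)

Support file for the DORMANT route `SwirlThreshold` (crux stmt-NavierStokesRegularity-2002) and
planner nsreg-p2's ROUND-18 assembly task T-18.5 (`EtaMoserBound → SwirlFreePolynomialBound`):
`EtaMoserBound` bounds `angVortQuot (V t) x = radQuot (swirl (curl (V t))) x` for a solution that is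
smooth only INSIDE an axis-centred parabolic cylinder, while the tree's evaluation
`radQuot_eq_div` (`radQuot S x = S x / r²` off the axis) asks `ContDiff ℝ 2 S` on all of `ℝ³`.
The bridge is LOCALITY: `radQuot S x = ∫₀¹ s ∫₀¹ ∂₀∂₀S(τ s x₀, s x₁, x₂) dτ ds` only sees `S` near
the "shrunken" points `(a x₀, b x₁, x₂)`, `a, b ∈ [0,1]`, which stay in every ball centred on the
axis at height-unrestricted centre `c` (`c₀ = c₁ = 0`) that contains `x`.

* `scaleFst_scaleH_apply`: `scaleFst τ (scaleH s x) = (τ s x₀, s x₁, x₂)` (coordinates);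
* `dist_scaleFst_scaleH_le`: its distance to an axis point `c` is `≤ dist x c`;
* `radQuot_congr_of_eqOn`: **if `S = S'` on an open set containing all these points then
  `radQuot S x = radQuot S' x`** — so `radQuot_eq_div` may be applied to any global `C²`
  axisymmetric modification `S'` of `S` (an axisymmetric cut-off of `S`), giving
  `angVortQuot V x = swirl (curl V) x / r²` off the axis for locally smooth `V`.

WHAT THIS IS NOT: not NS regularity — calculus bookkeeping for a quotient; `EtaMoserBound` and all
hard cores untouched; no crux claim.
-/

namespace Summit.NavierStokesRegularity.NavierStokesRegularity.Theorems.SwirlFreeBudget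

open Set Filter Topology Metric
open Literature.Analysis Literature.Analysis.FluidPDE

noncomputable section

/-- Coordinates of the doubly shrunken point: `scaleFst τ (scaleH s x) = (τ s x₀, s x₁, x₂)`. -/
theorem scaleFst_scaleH_apply (τ s : ℝ) (x : EuclideanSpace ℝ (Fin 3)) :
    scaleFst τ (scaleH s x) 0 = τ * (s * x 0) ∧ scaleFst τ (scaleH s x) 1 = s * x 1 ∧
      scaleFst τ (scaleH s x) 2 = x 2 := by
  refine ⟨?_, ?_, ?_⟩
  · rw [scaleFst_apply_zero, scaleH_apply_zero]
  · rw [scaleFst_apply_one, scaleH_apply_one]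
  · rw [scaleFst_apply_two, scaleH_apply_two]

/-- The shrunken points are no farther from an axis point `c` than `x` is (`τ, s ∈ [0,1]`). -/
theorem dist_scaleFst_scaleH_le {c : EuclideanSpace ℝ (Fin 3)} (hc : cylRadius c = 0)
    {τ s : ℝ} (hτ : τ ∈ Icc (0 : ℝ) 1) (hs : s ∈ Icc (0 : ℝ) 1) (x : EuclideanSpace ℝ (Fin 3)) :
    dist (scaleFst τ (scaleH s x)) c ≤ dist x c := by
  obtain ⟨hc0, hc1⟩ := (cylRadius_eq_zero_iff c).1 hc
  obtain ⟨h0, h1, h2⟩ := scaleFst_scaleH_apply τ s x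
  rw [dist_eq_norm, dist_eq_norm]
  rw [← sq_le_sq₀ (norm_nonneg _) (norm_nonneg _), EuclideanSpace.real_norm_sq_eq,
    EuclideanSpace.real_norm_sq_eq, Fin.sum_univ_three, Fin.sum_univ_three]
  simp only [PiLp.sub_apply, h0, h1, h2, hc0, hc1, sub_zero]
  have hτs : 0 ≤ τ * s ∧ τ * s ≤ 1 := ⟨mul_nonneg hτ.1 hs.1, by nlinarith [hτ.2, hs.2, hτ.1, hs.1]⟩
  have hp : (τ * s) ^ 2 ≤ 1 := pow_le_one₀ hτs.1 hτs.2
  have hp' : s ^ 2 ≤ 1 := pow_le_one₀ hs.1 hs.2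
  have e1 : (τ * (s * x 0)) ^ 2 ≤ x 0 ^ 2 := by
    rw [show τ * (s * x 0) = (τ * s) * x 0 by ring, mul_pow]
    nlinarith [mul_nonneg (sub_nonneg.2 hp) (sq_nonneg (x 0))]
  have e2 : (s * x 1) ^ 2 ≤ x 1 ^ 2 := by
    rw [mul_pow]; nlinarith [mul_nonneg (sub_nonneg.2 hp') (sq_nonneg (x 1))]
  linarith

/-- **LOCALITY OF THE RADIAL QUOTIENT**: if `S = S'` on an open set containing every shrunken point
`scaleFst τ (scaleH s x)`, `τ, s ∈ [0,1]`, then `radQuot S x = radQuot S' x`. -/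
theorem radQuot_congr_of_eqOn {S S' : EuclideanSpace ℝ (Fin 3) → ℝ} {U : Set (EuclideanSpace ℝ (Fin 3))}
    (hU : IsOpen U) (h : EqOn S S' U) {x : EuclideanSpace ℝ (Fin 3)}
    (hx : ∀ τ ∈ Icc (0 : ℝ) 1, ∀ s ∈ Icc (0 : ℝ) 1, scaleFst τ (scaleH s x) ∈ U) :
    radQuot S x = radQuot S' x := by
  -- first derivatives agree on `U`
  have h1 : ∀ y ∈ U, fderiv ℝ S y = fderiv ℝ S' y := fun y hy =>
    (h.eventuallyEq_of_mem (hU.mem_nhds hy)).fderiv_eq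
  have h1' : EqOn (fun y => fderiv ℝ S y (EuclideanSpace.single 0 1))
      (fun y => fderiv ℝ S' y (EuclideanSpace.single 0 1)) U := fun y hy => by
    simp only [h1 y hy]
  unfold radQuot
  refine intervalIntegral.integral_congr fun s hs => ?_
  rw [uIcc_of_le zero_le_one] at hs
  congr 1
  unfold radDerivQuot hadamardQuotFst
  refine intervalIntegral.integral_congr fun τ hτ => ?_
  rw [uIcc_of_le zero_le_one] at hτ
  exact congrFun (congrArg DFunLike.coe
    ((h1'.eventuallyEq_of_mem (hU.mem_nhds (hx τ hτ s hs))).fderiv_eq)) _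

/-- The locality in the form used at an axis-centred ball: if `S = S'` on `ball c R` with `c` on the
axis, then `radQuot S = radQuot S'` on `ball c R`. -/
theorem radQuot_congr_of_eqOn_ball {S S' : EuclideanSpace ℝ (Fin 3) → ℝ} {c : EuclideanSpace ℝ (Fin 3)}
    (hc : cylRadius c = 0) {R : ℝ} (h : EqOn S S' (ball c R)) {x : EuclideanSpace ℝ (Fin 3)}
    (hx : x ∈ ball c R) : radQuot S x = radQuot S' x :=
  radQuot_congr_of_eqOn isOpen_ball h fun _ hτ _ hs =>
    mem_ball.2 (lt_of_le_of_lt (dist_scaleFst_scaleH_le hc hτ hs x) (mem_ball.1 hx))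

end

end Summit.NavierStokesRegularity.NavierStokesRegularity.Theorems.SwirlFreeBudget
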